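import Literature.Claims.NS.ZgurovskyKasyanov2012

/-!
# C27 `ZgurovskyKasyanov2012` — the displayed identity of Step 2 fails

Claim examined (typed, landed p473554): `Literature.Claims.NS.ZgurovskyKasyanov2012.Step2a_TrilinearIdentity`, the identity
displayed in Step 2 of the proof of Theorem 2.1 of M. Z. Zgurovsky, P. O. Kasyanov, arXiv:1207.3290v1 (TeX l.345–348, print
p.5): «As `b(u,u,ω) − b(v,v,ω) = b(u+v,u−v,ω)` `∀ u,v,ω ∈ V`, then direct calculations provide …», typed for the paper's
`b(u,v,w) = ∫_Ω ((u·∇)v)·w` on every bounded `C^∞`-domain and all fields of (the smooth surrogate of) `V`.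

Result: `not_Step2a_TrilinearIdentity : ¬ Step2a_TrilinearIdentity`.  By trilinearity the displayed identity says
`b(u,v,ω) = b(v,u,ω)`; the Navier–Stokes trilinear form is not symmetric in its first two slots.  Countermodel (explicit,
kernel-checked): `Ω` = the open unit ball (`IsSmoothDomain` via `ρ(x) = ‖x‖² − 1`); planar solenoidal fields of product
form `a e₀ + b e₁`, `a = ∂₁ψ`, `b = −∂₀ψ` (divergence free by construction — no integration by parts): `u` from
`ψ = χ(x₀)·(x₁χ(x₁))·χ(x₂)` with `χ` a `C^∞` plateau bump (`= 1` on `|s| ≤ 1/4`, `= 0` on `|s| ≥ 1/2`), so `u ≡ e₀` on the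
open cube `P = {|xᵢ| < 1/4}`; `v` from `ψ = σ(x₀)σ(x₁)σ(x₂)` with `σ` a bump supported in `|s| ≤ 1/8 ⊂ P`; `z := ∂₀v ∈ V`.
Then `(v·∇)u ≡ 0` and `(u·∇)v = z`, so `b(u+v,u−v,z) = b(u,u,z) − ∫_Ω‖z‖² − b(v,v,z)` and the identity forces
`∫_Ω‖z‖² = 0`, while `z ≢ 0` (a mean-value point of `σ'`).  Cell vocabulary (D-0090): first failing step = Step 2
displayed identity (print p.5) = `Step2a_TrilinearIdentity`, class = false lemma (countermodel); the typed consequences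
`Step2_LipschitzH` ((2.10)) / `Step3_UniformV` ((2.11)) are not addressed here.

WHAT THIS IS NOT: not a claim about NS regularity or blow-up; not a claim about any author beyond the typed locator.
-/

set_option linter.dupNamespace false

noncomputable section

open Set Function MeasureTheory Metric Filter Topology
open scoped ContDiff ENNReal Topology RealInnerProductSpace

namespace Summit.NavierStokesRegularity.NavierStokesRegularity.Theorems.ZgurovskyKasyanov2012

open Literature.Claims.NS.ZgurovskyKasyanov2012 Literature.Analysis.FluidPDE

/-- Plateau bump: `= 1` on `|s| ≤ 1/4`, `= 0` on `|s| ≥ 1/2`. -/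
def Bχ : ContDiffBump (0 : ℝ) := ⟨1 / 4, 1 / 2, by norm_num, by norm_num⟩
/-- Small bump: `= 1` on `|s| ≤ 1/16`, `= 0` on `|s| ≥ 1/8`. -/
def Bσ : ContDiffBump (0 : ℝ) := ⟨1 / 16, 1 / 8, by norm_num, by norm_num⟩
/-- The plateau profile `χ`. -/
def χ : ℝ → ℝ := Bχ
/-- `χ'`. -/
def χ₁ : ℝ → ℝ := deriv χ
/-- The inner profile `σ`. -/
def σ : ℝ → ℝ := Bσ
/-- `σ'`. -/
def σ₁ : ℝ → ℝ := deriv σ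
/-- `σ''`. -/
def σ₂ : ℝ → ℝ := deriv σ₁
/-- `p(s) = s χ(s)`, so that `p' = 1` on the plateau. -/
def p (s : ℝ) : ℝ := s * χ s
/-- `p' = χ + s χ'`. -/
def p₁ (s : ℝ) : ℝ := χ s + s * χ₁ s

/-- `χ` is smooth. -/
theorem χ_contDiff : ContDiff ℝ ∞ χ := Bχ.contDiff
/-- `σ` is smooth. -/
theorem σ_contDiff : ContDiff ℝ ∞ σ := Bσ.contDiff
/-- `χ'` is smooth. -/
theorem χ₁_contDiff : ContDiff ℝ ∞ χ₁ := by have h := χ_contDiff.iterate_deriv 1; simpa [χ₁] using h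
/-- `σ'` is smooth. -/
theorem σ₁_contDiff : ContDiff ℝ ∞ σ₁ := by have h := σ_contDiff.iterate_deriv 1; simpa [σ₁] using h
/-- `σ''` is smooth. -/
theorem σ₂_contDiff : ContDiff ℝ ∞ σ₂ := by have h := σ₁_contDiff.iterate_deriv 1; simpa [σ₂] using h
/-- `p` is smooth. -/
theorem p_contDiff : ContDiff ℝ ∞ p := contDiff_id.mul χ_contDiff
/-- `p'` is smooth. -/
theorem p₁_contDiff : ContDiff ℝ ∞ p₁ := χ_contDiff.add (contDiff_id.mul χ₁_contDiff)

/-- `χ' = χ₁`. -/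
theorem hasDerivAt_χ (s : ℝ) : HasDerivAt χ (χ₁ s) s := ((χ_contDiff.differentiable (by simp)) s).hasDerivAt
/-- `χ₁' = deriv χ₁`. -/
theorem hasDerivAt_χ₁ (s : ℝ) : HasDerivAt χ₁ (deriv χ₁ s) s := ((χ₁_contDiff.differentiable (by simp)) s).hasDerivAt
/-- `σ' = σ₁`. -/
theorem hasDerivAt_σ (s : ℝ) : HasDerivAt σ (σ₁ s) s := ((σ_contDiff.differentiable (by simp)) s).hasDerivAt
/-- `σ₁' = σ₂`. -/
theorem hasDerivAt_σ₁ (s : ℝ) : HasDerivAt σ₁ (σ₂ s) s := ((σ₁_contDiff.differentiable (by simp)) s).hasDerivAt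
/-- `σ₂' = deriv σ₂`. -/
theorem hasDerivAt_σ₂ (s : ℝ) : HasDerivAt σ₂ (deriv σ₂ s) s := ((σ₂_contDiff.differentiable (by simp)) s).hasDerivAt
/-- `p' = p₁`. -/
theorem hasDerivAt_p (s : ℝ) : HasDerivAt p (p₁ s) s := by
  have h := (hasDerivAt_id s).mul (hasDerivAt_χ s)
  have e1 : p = (id * χ : ℝ → ℝ) := by funext y; simp [p]
  rw [e1]
  exact h.congr_deriv (by simp [p₁])
/-- `p₁' = deriv p₁`. -/
theorem hasDerivAt_p₁ (s : ℝ) : HasDerivAt p₁ (deriv p₁ s) s := ((p₁_contDiff.differentiable (by simp)) s).hasDerivAt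

/-- `χ = 1` on the plateau. -/
theorem χ_eq_one {s : ℝ} (hs : |s| ≤ 1 / 4) : χ s = 1 := Bχ.one_of_mem_closedBall (by simpa [Bχ, Real.dist_eq] using hs)
/-- `χ = 0` off `|s| < 1/2`. -/
theorem χ_eq_zero {s : ℝ} (hs : 1 / 2 ≤ |s|) : χ s = 0 := Bχ.zero_of_le_dist (by simpa [Bχ, Real.dist_eq] using hs)
/-- `σ = 0` off `|s| < 1/8`. -/
theorem σ_eq_zero {s : ℝ} (hs : 1 / 8 ≤ |s|) : σ s = 0 := Bσ.zero_of_le_dist (by simpa [Bσ, Real.dist_eq] using hs)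
/-- `σ(0) = 1`. -/
theorem σ_zero_eq : σ 0 = 1 := Bσ.one_of_mem_closedBall (by simp [Bσ])

/-- `χ' = 0` on the open plateau. -/
theorem χ₁_eq_zero_of_lt {s : ℝ} (hs : |s| < 1 / 4) : χ₁ s = 0 := by
  have ho : IsOpen {r : ℝ | |r| < 1 / 4} := isOpen_lt continuous_abs continuous_const
  have h : χ =ᶠ[𝓝 s] fun _ => (1 : ℝ) := Filter.eventually_of_mem (ho.mem_nhds hs) fun _ hr => χ_eq_one (le_of_lt hr)
  rw [χ₁, h.deriv_eq]; simp
/-- `χ' = 0` off the support. -/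
theorem χ₁_eq_zero_of_gt {s : ℝ} (hs : 1 / 2 < |s|) : χ₁ s = 0 := by
  have ho : IsOpen {r : ℝ | 1 / 2 < |r|} := isOpen_lt continuous_const continuous_abs
  have h : χ =ᶠ[𝓝 s] fun _ => (0 : ℝ) := Filter.eventually_of_mem (ho.mem_nhds hs) fun _ hr => χ_eq_zero (le_of_lt hr)
  rw [χ₁, h.deriv_eq]; simp
/-- The open set `|s| > 1/8`. -/
theorem isOpen_far : IsOpen {r : ℝ | 1 / 8 < |r|} := isOpen_lt continuous_const continuous_abs
/-- `σ` vanishes near every point with `|s| > 1/8`. -/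
theorem σ_eventuallyEq_zero {s : ℝ} (hs : 1 / 8 < |s|) : σ =ᶠ[𝓝 s] fun _ => (0 : ℝ) :=
  Filter.eventually_of_mem (isOpen_far.mem_nhds hs) fun _ hr => σ_eq_zero (le_of_lt hr)
/-- `σ' = 0` off the support. -/
theorem σ₁_eq_zero {s : ℝ} (hs : 1 / 8 < |s|) : σ₁ s = 0 := by rw [σ₁, (σ_eventuallyEq_zero hs).deriv_eq]; simp
/-- `σ'` vanishes near every point with `|s| > 1/8`. -/
theorem σ₁_eventuallyEq_zero {s : ℝ} (hs : 1 / 8 < |s|) : σ₁ =ᶠ[𝓝 s] fun _ => (0 : ℝ) :=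
  Filter.eventually_of_mem (isOpen_far.mem_nhds hs) fun _ hr => σ₁_eq_zero hr
/-- `σ'' = 0` off the support. -/
theorem σ₂_eq_zero {s : ℝ} (hs : 1 / 8 < |s|) : σ₂ s = 0 := by rw [σ₂, (σ₁_eventuallyEq_zero hs).deriv_eq]; simp
/-- `p = 0` off the support. -/
theorem p_eq_zero {s : ℝ} (hs : 1 / 2 ≤ |s|) : p s = 0 := by simp [p, χ_eq_zero hs]
/-- `p' = 0` off the support. -/
theorem p₁_eq_zero {s : ℝ} (hs : 1 / 2 < |s|) : p₁ s = 0 := by simp [p₁, χ_eq_zero hs.le, χ₁_eq_zero_of_gt hs]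
/-- `p' = 1` on the open plateau. -/
theorem p₁_eq_one {s : ℝ} (hs : |s| < 1 / 4) : p₁ s = 1 := by simp [p₁, χ_eq_one hs.le, χ₁_eq_zero_of_lt hs]
/-- A point where `σ' ≠ 0` (mean value theorem on `[-1, 0]`). -/
theorem exists_σ₁_ne_zero : ∃ ξ : ℝ, σ₁ ξ ≠ 0 := by
  obtain ⟨ξ, -, hξ⟩ := exists_deriv_eq_slope σ (show (-1 : ℝ) < 0 by norm_num) σ_contDiff.continuous.continuousOn
    (fun r _ => ((σ_contDiff.differentiable (by simp)) r).differentiableWithinAt)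
  have h1 : σ (-1) = 0 := σ_eq_zero (by norm_num)
  exact ⟨ξ, by rw [σ₁, hξ, σ_zero_eq, h1]; norm_num⟩

/-- Product form: `T f g h (x) = f(x₀) g(x₁) h(x₂)`. -/
def T (f g h : ℝ → ℝ) (x : E3) : ℝ := f (x 0) * g (x 1) * h (x 2)
/-- Coordinate projections as continuous linear maps. -/
abbrev π (i : Fin 3) : E3 →L[ℝ] ℝ := EuclideanSpace.proj i
/-- Chain rule through a coordinate. -/
theorem hasFDerivAt_coord {f : ℝ → ℝ} {f' : ℝ} {x : E3} (i : Fin 3) (hf : HasDerivAt f f' (x i)) :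
    HasFDerivAt (fun y : E3 => f (y i)) (f' • π i) x := hf.comp_hasFDerivAt x (π i).hasFDerivAt
/-- The derivative of a product-form field, in coordinates. -/
def DT (f' g' h' : ℝ) (f g h : ℝ → ℝ) (x : E3) : E3 →L[ℝ] ℝ :=
  (f' * g (x 1) * h (x 2)) • π 0 + (f (x 0) * g' * h (x 2)) • π 1 + (f (x 0) * g (x 1) * h') • π 2
/-- Product rule for `T`. -/
theorem hasFDerivAt_T {f g h : ℝ → ℝ} {f' g' h' : ℝ} {x : E3} (hf : HasDerivAt f f' (x 0))
    (hg : HasDerivAt g g' (x 1)) (hh : HasDerivAt h h' (x 2)) :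
    HasFDerivAt (T f g h) (DT f' g' h' f g h x) x := by
  have H := ((hasFDerivAt_coord 0 hf).mul (hasFDerivAt_coord 1 hg)).mul (hasFDerivAt_coord 2 hh)
  refine H.congr_fderiv ?_
  ext w; simp [DT, mul_comm, mul_left_comm, mul_assoc]; ring
/-- `T` of smooth profiles is smooth. -/
theorem T_contDiff {f g h : ℝ → ℝ} (hf : ContDiff ℝ ∞ f) (hg : ContDiff ℝ ∞ g) (hh : ContDiff ℝ ∞ h) :
    ContDiff ℝ ∞ (T f g h) :=
  ((hf.comp (π 0).contDiff).mul (hg.comp (π 1).contDiff)).mul (hh.comp (π 2).contDiff)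
/-- `DT` evaluated. -/
theorem DT_apply (f' g' h' : ℝ) (f g h : ℝ → ℝ) (x w : E3) :
    DT f' g' h' f g h x w = f' * g (x 1) * h (x 2) * w 0 + f (x 0) * g' * h (x 2) * w 1 + f (x 0) * g (x 1) * h' * w 2 := by
  simp [DT]

/-- The planar vector field with components `(a, b, 0)`. -/
def vf (a b : E3 → ℝ) (x : E3) : E3 := a x • e 0 + b x • e 1
/-- Derivative of `vf a b`. -/
theorem hasFDerivAt_vf {a b : E3 → ℝ} {a' b' : E3 →L[ℝ] ℝ} {x : E3} (ha : HasFDerivAt a a' x)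
    (hb : HasFDerivAt b b' x) : HasFDerivAt (vf a b) (a'.smulRight (e 0) + b'.smulRight (e 1)) x :=
  (ha.smul_const (e 0)).add (hb.smul_const (e 1))
/-- Smoothness of `vf a b`. -/
theorem vf_contDiff {a b : E3 → ℝ} (ha : ContDiff ℝ ∞ a) (hb : ContDiff ℝ ∞ b) : ContDiff ℝ ∞ (vf a b) :=
  (ha.smul contDiff_const).add (hb.smul contDiff_const)
/-- `div (a e₀ + b e₁) = ∂₀ a + ∂₁ b`. -/
theorem divergence_vf {a b : E3 → ℝ} {a' b' : E3 →L[ℝ] ℝ} {x : E3} (ha : HasFDerivAt a a' x)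
    (hb : HasFDerivAt b b' x) : VectorCalculus.divergence (vf a b) x = a' (e 0) + b' (e 1) := by
  rw [divergence_eq_sum_inner_fderiv (EuclideanSpace.basisFun (Fin 3) ℝ), (hasFDerivAt_vf ha hb).fderiv]
  simp [Fin.sum_univ_three, e, inner_add_right, inner_smul_right, EuclideanSpace.inner_single_right]

/-- First component of `u = ∇⊥(χ(x₀) p(x₁) χ(x₂))`. -/
def au : E3 → ℝ := T χ p₁ χ
/-- Second component of `u`. -/
def bu : E3 → ℝ := fun x => -T χ₁ p χ x
/-- First component of `v = ∇⊥(σ(x₀) σ(x₁) σ(x₂))`. -/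
def av : E3 → ℝ := T σ σ₁ σ
/-- Second component of `v`. -/
def bv : E3 → ℝ := fun x => -T σ₁ σ σ x
/-- First component of `z = ∂₀ v`. -/
def az : E3 → ℝ := T σ₁ σ₁ σ
/-- Second component of `z`. -/
def bz : E3 → ℝ := fun x => -T σ₂ σ σ x
/-- The field `u` (equal to `e₀` on the plateau cube). -/
def u : E3 → E3 := vf au bu
/-- The field `v` (supported inside the plateau cube). -/
def v : E3 → E3 := vf av bv
/-- The field `z = ∂₀ v`. -/
def z : E3 → E3 := vf az bz

/-- Derivative of `u`. -/
theorem hasFDerivAt_u (x : E3) : HasFDerivAt u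
    ((DT (χ₁ (x 0)) (deriv p₁ (x 1)) (χ₁ (x 2)) χ p₁ χ x).smulRight (e 0) +
      (-DT (deriv χ₁ (x 0)) (p₁ (x 1)) (χ₁ (x 2)) χ₁ p χ x).smulRight (e 1)) x :=
  hasFDerivAt_vf (hasFDerivAt_T (hasDerivAt_χ _) (hasDerivAt_p₁ _) (hasDerivAt_χ _))
    (hasFDerivAt_T (hasDerivAt_χ₁ _) (hasDerivAt_p _) (hasDerivAt_χ _)).neg
/-- Derivative of `v`. -/
theorem hasFDerivAt_v (x : E3) : HasFDerivAt v
    ((DT (σ₁ (x 0)) (σ₂ (x 1)) (σ₁ (x 2)) σ σ₁ σ x).smulRight (e 0) +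
      (-DT (σ₂ (x 0)) (σ₁ (x 1)) (σ₁ (x 2)) σ₁ σ σ x).smulRight (e 1)) x :=
  hasFDerivAt_vf (hasFDerivAt_T (hasDerivAt_σ _) (hasDerivAt_σ₁ _) (hasDerivAt_σ _))
    (hasFDerivAt_T (hasDerivAt_σ₁ _) (hasDerivAt_σ _) (hasDerivAt_σ _)).neg
/-- `u` is smooth. -/
theorem u_contDiff : ContDiff ℝ ∞ u :=
  vf_contDiff (T_contDiff χ_contDiff p₁_contDiff χ_contDiff)
    (show ContDiff ℝ ∞ fun x => -T χ₁ p χ x from (T_contDiff χ₁_contDiff p_contDiff χ_contDiff).neg)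
/-- `v` is smooth. -/
theorem v_contDiff : ContDiff ℝ ∞ v :=
  vf_contDiff (T_contDiff σ_contDiff σ₁_contDiff σ_contDiff)
    (show ContDiff ℝ ∞ fun x => -T σ₁ σ σ x from (T_contDiff σ₁_contDiff σ_contDiff σ_contDiff).neg)
/-- `z` is smooth. -/
theorem z_contDiff : ContDiff ℝ ∞ z :=
  vf_contDiff (T_contDiff σ₁_contDiff σ₁_contDiff σ_contDiff)
    (show ContDiff ℝ ∞ fun x => -T σ₂ σ σ x from (T_contDiff σ₂_contDiff σ_contDiff σ_contDiff).neg)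
/-- `div u = 0` (product form). -/
theorem divergence_u (x : E3) : VectorCalculus.divergence u x = 0 := by
  rw [u, divergence_vf (a := au) (b := bu) (x := x) (hasFDerivAt_T (hasDerivAt_χ _) (hasDerivAt_p₁ _) (hasDerivAt_χ _))
    (hasFDerivAt_T (hasDerivAt_χ₁ _) (hasDerivAt_p _) (hasDerivAt_χ _)).neg]
  simp [DT_apply, e]
/-- `div v = 0` (product form). -/
theorem divergence_v (x : E3) : VectorCalculus.divergence v x = 0 := by
  rw [v, divergence_vf (a := av) (b := bv) (x := x) (hasFDerivAt_T (hasDerivAt_σ _) (hasDerivAt_σ₁ _) (hasDerivAt_σ _))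
    (hasFDerivAt_T (hasDerivAt_σ₁ _) (hasDerivAt_σ _) (hasDerivAt_σ _)).neg]
  simp [DT_apply, e]
/-- `div z = 0` (product form). -/
theorem divergence_z (x : E3) : VectorCalculus.divergence z x = 0 := by
  rw [z, divergence_vf (a := az) (b := bz) (x := x) (hasFDerivAt_T (hasDerivAt_σ₁ _) (hasDerivAt_σ₁ _) (hasDerivAt_σ _))
    (hasFDerivAt_T (hasDerivAt_σ₂ _) (hasDerivAt_σ _) (hasDerivAt_σ _)).neg]
  simp [DT_apply, e]

/-- The open plateau cube `P = {|xᵢ| < 1/4}`, on which `u ≡ e₀` and outside which `v = z = 0`. -/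
def P : Set E3 := {x | ∀ i, |x i| < 1 / 4}
/-- `P` is open. -/
theorem isOpen_P : IsOpen P := by
  have : P = ⋂ i : Fin 3, {x : E3 | |x i| < 1 / 4} := by ext x; simp [P]
  rw [this]
  exact isOpen_iInter_of_finite fun i => isOpen_lt (continuous_abs.comp (π i).continuous) continuous_const
/-- `u = e₀` on `P`. -/
theorem u_eq_of_mem_P {x : E3} (hx : x ∈ P) : u x = e 0 := by
  have h0 := χ_eq_one (hx 0).le; have h1 := p₁_eq_one (hx 1); have h2 := χ_eq_one (hx 2).le
  have h3 := χ₁_eq_zero_of_lt (hx 0)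
  simp [u, vf, au, bu, T, h0, h1, h2, h3]
/-- `Du = 0` on `P`. -/
theorem fderiv_u_of_mem_P {x : E3} (hx : x ∈ P) : fderiv ℝ u x = 0 := by
  have h : u =ᶠ[𝓝 x] fun _ => e 0 := Filter.eventually_of_mem (isOpen_P.mem_nhds hx) fun _ hy => u_eq_of_mem_P hy
  exact ((hasFDerivAt_const (e 0) x).congr_of_eventuallyEq h).fderiv
/-- Outside `P` some coordinate exceeds `1/8` in absolute value. -/
theorem exists_far_of_not_mem_P {x : E3} (hx : x ∉ P) : ∃ i, 1 / 8 < |x i| := by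
  simp only [P, mem_setOf_eq, not_forall, not_lt] at hx
  obtain ⟨i, hi⟩ := hx; exact ⟨i, by linarith⟩
/-- `v = 0` far from the origin. -/
theorem v_eq_zero_of_far {x : E3} {i : Fin 3} (hi : 1 / 8 < |x i|) : v x = 0 := by
  have h0 := σ_eq_zero hi.le; have h1 := σ₁_eq_zero hi
  fin_cases i <;> simp_all [v, vf, av, bv, T]
/-- `z = 0` far from the origin. -/
theorem z_eq_zero_of_far {x : E3} {i : Fin 3} (hi : 1 / 8 < |x i|) : z x = 0 := by
  have h0 := σ_eq_zero hi.le; have h1 := σ₁_eq_zero hi; have h2 := σ₂_eq_zero hi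
  fin_cases i <;> simp_all [z, vf, az, bz, T]
/-- `(v·∇)u ≡ 0`: `u` is constant wherever `v ≠ 0`. -/
theorem convect_v_u (x : E3) : convect v u x = 0 := by
  by_cases hx : x ∈ P
  · simp [convect_apply, fderiv_u_of_mem_P hx]
  · obtain ⟨i, hi⟩ := exists_far_of_not_mem_P hx
    simp [convect_apply, v_eq_zero_of_far hi]
/-- `(u·∇)v = ∂₀ v = z` everywhere. -/
theorem convect_u_v (x : E3) : convect u v x = z x := by
  rw [convect_apply, (hasFDerivAt_v x).fderiv]
  by_cases hx : x ∈ P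
  · rw [u_eq_of_mem_P hx]
    simp [DT_apply, z, vf, az, bz, T, e]
  · obtain ⟨i, hi⟩ := exists_far_of_not_mem_P hx
    have h0 := σ_eq_zero hi.le; have h1 := σ₁_eq_zero hi; have h2 := σ₂_eq_zero hi
    fin_cases i <;> simp_all [DT_apply, z, vf, az, bz, T]

/-- The domain: the open unit ball. -/
def Ω : Set E3 := ball 0 1
/-- The unit ball is a bounded `C^∞`-domain in the typed sense (`ρ(x) = ‖x‖² − 1`). -/
theorem isSmoothDomain_Ω : IsSmoothDomain Ω := by
  refine ⟨isBounded_ball, fun x => ‖x‖ ^ 2 - 1, (contDiff_norm_sq ℝ).sub contDiff_const, ?_, ?_⟩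
  · ext x
    simp only [Ω, mem_ball_zero_iff, mem_setOf_eq, sub_neg]
    constructor <;> intro h <;> nlinarith [norm_nonneg x]
  · intro x hx h0
    have hx' : ‖x‖ ^ 2 = 1 := by linarith
    have hd : HasFDerivAt (fun y : E3 => ‖y‖ ^ 2 - 1) (2 • innerSL ℝ x) x := by
      simpa using (hasStrictFDerivAt_norm_sq x).hasFDerivAt.sub_const (1 : ℝ)
    have h1 : fderiv ℝ (fun y : E3 => ‖y‖ ^ 2 - 1) x = 0 := by
      have := congrArg (InnerProductSpace.toDual ℝ E3) h0; simpa [gradient] using this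
    rw [hd.fderiv] at h1
    have h2 := congrArg (fun L : E3 →L[ℝ] ℝ => L x) h1
    simp [hx'] at h2
/-- Outside the ball some coordinate exceeds `1/2` in absolute value. -/
theorem exists_coord_gt {x : E3} (hx : x ∉ Ω) : ∃ i, 1 / 2 < |x i| := by
  rw [Ω, mem_ball_zero_iff, not_lt] at hx
  by_contra h
  simp only [not_exists, not_lt] at h
  have h0 := h 0; have h1 := h 1; have h2 := h 2
  have e : ‖x‖ ^ 2 = x 0 ^ 2 + x 1 ^ 2 + x 2 ^ 2 := by rw [EuclideanSpace.norm_sq_eq]; simp [Fin.sum_univ_three]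
  nlinarith [abs_nonneg (x 0), abs_nonneg (x 1), abs_nonneg (x 2), sq_abs (x 0), sq_abs (x 1), sq_abs (x 2), norm_nonneg x]
/-- `u = 0` outside `Ω`. -/
theorem u_eq_zero {x : E3} (hx : x ∉ Ω) : u x = 0 := by
  obtain ⟨i, hi⟩ := exists_coord_gt hx
  have h0 := χ_eq_zero hi.le; have h1 := χ₁_eq_zero_of_gt hi; have h2 := p_eq_zero hi.le; have h3 := p₁_eq_zero hi
  fin_cases i <;> simp_all [u, vf, au, bu, T]
/-- Outside `Ω` some coordinate exceeds `1/8` in absolute value. -/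
theorem far_of_not_mem {x : E3} (hx : x ∉ Ω) : ∃ i, 1 / 8 < |x i| := by obtain ⟨i, hi⟩ := exists_coord_gt hx; exact ⟨i, by linarith⟩
/-- `v = 0` outside `Ω`. -/
theorem v_eq_zero {x : E3} (hx : x ∉ Ω) : v x = 0 := by obtain ⟨i, hi⟩ := far_of_not_mem hx; exact v_eq_zero_of_far hi
/-- `z = 0` outside `Ω`. -/
theorem z_eq_zero {x : E3} (hx : x ∉ Ω) : z x = 0 := by obtain ⟨i, hi⟩ := far_of_not_mem hx; exact z_eq_zero_of_far hi
/-- Fields vanishing outside `Ω` have compact support. -/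
theorem hasCompactSupport_of_zero {w : E3 → E3} (hw : ∀ x, x ∉ Ω → w x = 0) : HasCompactSupport w :=
  HasCompactSupport.intro (isCompact_closedBall (0 : E3) 1) fun x hx => hw x fun h => hx (ball_subset_closedBall h)
/-- `∫_Ω ‖∇w‖² < ∞` for a smooth compactly supported field. -/
theorem lintegral_fderiv_lt_top {w : E3 → E3} (hw : ContDiff ℝ ∞ w) (hc : HasCompactSupport w) :
    ∫⁻ x in Ω, ‖fderiv ℝ w x‖ₑ ^ 2 < ⊤ := by
  obtain ⟨C, hC⟩ := (hw.continuous_fderiv (by simp)).bounded_above_of_compact_support (hc.fderiv (𝕜 := ℝ))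
  calc ∫⁻ x in Ω, ‖fderiv ℝ w x‖ₑ ^ 2 ≤ ∫⁻ _ in Ω, ENNReal.ofReal C ^ 2 := by
        refine lintegral_mono fun x => ?_
        gcongr; rw [← ofReal_norm]; exact ENNReal.ofReal_le_ofReal (hC x)
    _ = ENNReal.ofReal C ^ 2 * volume Ω := setLIntegral_const _ _
    _ < ⊤ := ENNReal.mul_lt_top (ENNReal.pow_lt_top ENNReal.ofReal_lt_top) measure_ball_lt_top
/-- Membership in the typed `V` for smooth fields vanishing outside `Ω` with zero divergence. -/
theorem inV_of {w : E3 → E3} (hw : ContDiff ℝ ∞ w) (h0 : ∀ x, x ∉ Ω → w x = 0)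
    (hdiv : ∀ x, VectorCalculus.divergence w x = 0) : InV Ω w :=
  ⟨hw.continuous, (hw.of_le (by simp)).contDiffOn, h0, fun x _ => hdiv x, lintegral_fderiv_lt_top hw (hasCompactSupport_of_zero h0)⟩
/-- `u ∈ V`. -/
theorem u_inV : InV Ω u := inV_of u_contDiff (fun _ hx => u_eq_zero hx) divergence_u
/-- `v ∈ V`. -/
theorem v_inV : InV Ω v := inV_of v_contDiff (fun _ hx => v_eq_zero hx) divergence_v
/-- `z ∈ V`. -/
theorem z_inV : InV Ω z := inV_of z_contDiff (fun _ hx => z_eq_zero hx) divergence_z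

/-- Pointwise: `((u+v)·∇)(u−v)·z = ((u·∇)u)·z − ‖z‖² − ((v·∇)v)·z`. -/
theorem integrand_eq (x : E3) :
    ⟪convect (u + v) (u - v) x, z x⟫ = ⟪convect u u x, z x⟫ - ‖z x‖ ^ 2 - ⟪convect v v x, z x⟫ := by
  have h1 : fderiv ℝ (u - v) x = fderiv ℝ u x - fderiv ℝ v x := by
    first
      | exact fderiv_sub' (hasFDerivAt_u x).differentiableAt (hasFDerivAt_v x).differentiableAt
      | exact fderiv_sub (hasFDerivAt_u x).differentiableAt (hasFDerivAt_v x).differentiableAt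
  have hvu : fderiv ℝ u x (v x) = 0 := convect_v_u x
  have huv : fderiv ℝ v x (u x) = z x := convect_u_v x
  simp only [convect_apply, Pi.add_apply, h1, sub_apply, map_add, hvu, huv]
  rw [← real_inner_self_eq_norm_sq]; simp only [inner_sub_left, inner_add_left, inner_zero_left]; ring
/-- `x ↦ g(x)·z(x)` is integrable on `Ω` for continuous `g`. -/
theorem integrableOn_inner {g : E3 → E3} (hg : Continuous g) : IntegrableOn (fun x => ⟪g x, z x⟫) Ω := by
  refine (Continuous.integrable_of_hasCompactSupport (hg.inner z_contDiff.continuous) ?_).integrableOn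
  exact HasCompactSupport.intro (isCompact_closedBall (0 : E3) 1) fun x hx => by
    rw [z_eq_zero fun h => hx (ball_subset_closedBall h), inner_zero_right]
/-- `(w·∇)w` is continuous for smooth `w`. -/
theorem continuous_convect_self {w : E3 → E3} (hw : ContDiff ℝ ∞ w) : Continuous (convect w w) :=
  (hw.continuous_fderiv (by simp)).clm_apply hw.continuous
/-- `b(u+v,u−v,z) = b(u,u,z) − ∫_Ω ‖z‖² − b(v,v,z)` on the witness. -/
theorem bform_expand :
    bform Ω (u + v) (u - v) z = bform Ω u u z - (∫ x in Ω, ‖z x‖ ^ 2) - bform Ω v v z := by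
  have hI1 : IntegrableOn (fun x => ⟪convect u u x, z x⟫) Ω := integrableOn_inner (continuous_convect_self u_contDiff)
  have hI2 : IntegrableOn (fun x => ⟪convect v v x, z x⟫) Ω := integrableOn_inner (continuous_convect_self v_contDiff)
  have hI3 : IntegrableOn (fun x => ‖z x‖ ^ 2) Ω := by
    have := integrableOn_inner z_contDiff.continuous; simpa only [real_inner_self_eq_norm_sq] using this
  have hc : (∫ x in Ω, ⟪convect (u + v) (u - v) x, z x⟫) =
      ∫ x in Ω, ((⟪convect u u x, z x⟫ - ‖z x‖ ^ 2) - ⟪convect v v x, z x⟫) :=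
    integral_congr_ae (Filter.Eventually.of_forall integrand_eq)
  have hI13 : IntegrableOn (fun x => ⟪convect u u x, z x⟫ - ‖z x‖ ^ 2) Ω := hI1.sub hI3
  simp only [bform]; rw [hc, integral_sub hI13 hI2, integral_sub hI1 hI3]
/-- `z ≢ 0`. -/
theorem exists_z_ne_zero : ∃ x : E3, z x ≠ 0 := by
  obtain ⟨ξ, hξ⟩ := exists_σ₁_ne_zero
  refine ⟨ξ • e 0 + ξ • e 1, fun h => ?_⟩
  have h0 := congrArg (fun w : E3 => w 0) h
  simp [z, vf, az, bz, T, e, σ_zero_eq, hξ] at h0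
/-- `∫_Ω ‖z‖² > 0`. -/
theorem integral_pos : 0 < ∫ x in Ω, ‖z x‖ ^ 2 := by
  rw [setIntegral_eq_integral_of_forall_compl_eq_zero (fun x hx => by simp [z_eq_zero hx])]
  obtain ⟨x₀, hx₀⟩ := exists_z_ne_zero
  have hcs : HasCompactSupport fun x => ‖z x‖ ^ 2 :=
    HasCompactSupport.intro (isCompact_closedBall (0 : E3) 1) fun x hx => by simp [z_eq_zero fun h => hx (ball_subset_closedBall h)]
  exact (z_contDiff.continuous.norm.pow 2).integral_pos_of_hasCompactSupport_nonneg_nonzero hcs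
    (fun x => sq_nonneg _) (by simpa using hx₀)

/-- **C27, Step 2 displayed identity (print p.5) is false as typed:** the trilinear form is not
symmetric in its first two arguments; witness `(Ω, u, v, z)` above, for which the identity would force
`∫_Ω ‖z‖² = 0`.  Class: false lemma (countermodel). -/
theorem not_Step2a_TrilinearIdentity : ¬ Step2a_TrilinearIdentity := by
  intro h
  have hid := h Ω isSmoothDomain_Ω u v z u_inV v_inV z_inV
  rw [bform_expand] at hid
  linarith [integral_pos]

end Summit.NavierStokesRegularity.NavierStokesRegularity.Theorems.ZgurovskyKasyanov2012
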